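import Literature.AnabelianGeometry.SemiGraphs.TemperedCuspidalAbsolutenessOfProCusps
import Literature.AnabelianGeometry.SemiGraphs.TemperedSpecialFibreTowerPiDataWitness
import HarnessLib

/-!
# Non-vacuity (cuspless part) of the levelwise cusp–graph binder of
# `TemperedCuspidalAbsolutenessOfProCusps.lean`

Mochizuki, *Semi-graphs of anabelioids*, Publ. RIMS **42** (2006) [SemiAnbd], §6 Thm. 6.5 (iii) p. 72 /
Example 3.10 p. 44 [cite: MochizukiSemiAnbd2006, Thm 6.5(iii) p.72].

PROOF-ONLY consistency file (abc-iut cell, seat abc-iut-L3-t11 gen 5; L3-lead β49 rider (r1): "NV row NAMED").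
The binder `hLG` of `TemperedOrigin.inertiaLeaf_of_levelwiseCuspGraphIso` asks, per certified pair and `γ`, for
Example 3.10 towers, `Π^temp`-actions on the level semi-graphs, pro-cusp systems with the stabiliser reading of the
inertia groups, and `γ`-equivariant levelwise semi-graph isomorphisms matching pro-cusps.  Here:

* `TemperedCurve.levelwiseCuspGraphIso_data_of_isEmpty_pt` — at a §6 datum WITHOUT closed points that carries an
  Example 3.10 tower `T`, the binder's data exist for every `γ : Δ^temp ⥲ Δ^temp` (both towers `T`, trivial graph
  actions, identity isomorphisms; the cusp clauses are VACUOUS — there are no cusps);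
* `TemperedOrigin.exists_principal_levelwiseCuspGraphIso` — hence at the principal certificate of the tree's
  cuspless tower-carrying datum (`SpecialFibreTower.PiData.exists_temperedCurve_padicAffine`, abc-iut-L3-t2:
  `Π^temp = G_{ℚ_p} × Aff(ℤ_p)`, `p ≠ 2`) the whole hypothesis `hLG` HOLDS.

HONEST LABEL: this certifies the joint satisfiability of the tower / action / isomorphism / equivariance clauses
with a genuine `SpecialFibreTower` only; the two cusp clauses (the pro-cusp reading «`I_x = Stab`» and the cusp
matching) are vacuous here.  A CUSPED witness (a tower over a slim `Δ^temp` with a cusp whose inertia group is a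
proper stabiliser) is the named open row «NV-hLG@cusped»; note that NO `SpecialFibreTower` exists over a
non-trivial abelian `Δ` (the field `faithful` forces `N_i = ⊤`), so the punctured-disc toy of
`TemperedOrigin.exists_principal_cor311Leaves` (`Δ^temp = Ẑ`) cannot carry the binder.  Nothing here concerns
curves; no side taken on [IUTchIII] Cor. 3.12.
-/

noncomputable section

namespace Literature.AnabelianGeometry.SemiGraphs

open CategoryTheory
open scoped Pointwise

namespace TemperedCurve

variable {p : ℕ} [Fact p.Prime]

/-- **The binder's data at a cuspless tower-carrying datum**: for `X` with no closed points and an Example 3.10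
tower `T` over `Δ^temp_X`, and any `γ : Δ^temp_X ⥲ Δ^temp_X`, take both towers `:= T`, the trivial actions,
no cusp systems (there are no cusps) and the identity isomorphisms; all clauses hold (the cusp clauses
vacuously). [cite: MochizukiSemiAnbd2006, Ex 3.10 p.44] -/
theorem levelwiseCuspGraphIso_data_of_isEmpty_pt (X : TemperedCurve p) (hX : IsEmpty X.Pt)
    (T : SpecialFibreTower X.DeltaTemp) (γ : X.DeltaTemp ≃ₜ* X.DeltaTemp) :
    ∃ (TX : SpecialFibreTower X.DeltaTemp) (TY : SpecialFibreTower X.DeltaTemp)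
      (AX : ∀ i, X.PiTemp →* Aut (TX.Gc i).graph) (AY : ∀ i, X.PiTemp →* Aut (TY.Gc i).graph)
      (cX : ∀ i, {x : X.Pt // X.IsCusp x} → (TX.Gc i).graph.Edge)
      (cY : ∀ i, {y : X.Pt // X.IsCusp y} → (TY.Gc i).graph.Edge)
      (FI : ∀ i, (TX.Gc i).graph ≅ (TY.Gc i).graph),
      (∀ (x : {x : X.Pt // X.IsCusp x}) (g : X.DeltaTemp), (g : X.PiTemp) ∈ X.inertia x.1 ↔
          ∀ i, (AX i (g : X.PiTemp)).hom.edgeMap (cX i x) = cX i x) ∧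
      (∀ (y : {y : X.Pt // X.IsCusp y}) (h : X.DeltaTemp), (h : X.PiTemp) ∈ X.inertia y.1 ↔
          ∀ i, (AY i (h : X.PiTemp)).hom.edgeMap (cY i y) = cY i y) ∧
      (∀ (i) (g : X.DeltaTemp) (e : (TX.Gc i).graph.Edge),
          (FI i).hom.edgeMap ((AX i (g : X.PiTemp)).hom.edgeMap e) =
            (AY i ((γ g : X.DeltaTemp) : X.PiTemp)).hom.edgeMap ((FI i).hom.edgeMap e)) ∧
      (∀ x : {x : X.Pt // X.IsCusp x}, ∃ (y : {y : X.Pt // X.IsCusp y}) (δ : X.PiTemp),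
          ∀ i, (FI i).hom.edgeMap (cX i x) = (AY i δ).hom.edgeMap (cY i y)) := by
  refine ⟨T, T, fun _ => 1, fun _ => 1, fun _ x => (hX.false x.1).elim, fun _ y => (hX.false y.1).elim,
    fun i => Iso.refl _, fun x => (hX.false x.1).elim, fun y => (hX.false y.1).elim, ?_,
    fun x => (hX.false x.1).elim⟩
  intro i g e
  rfl

end TemperedCurve

namespace TemperedOrigin

/-- **NON-VACUITY (cuspless part) of the binder `hLG`** of `inertiaLeaf_of_levelwiseCuspGraphIso` /
`cuspidalAbsolutenessHolds_of_levelwiseCuspGraphIso`: at the principal certificate `Ω := (· = X)` of the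
tree's cuspless §6 datum carrying an Example 3.10 tower (abc-iut-L3-t2's
`SpecialFibreTower.PiData.exists_temperedCurve_padicAffine`, `Π^temp = G_{ℚ_p} × Aff(ℤ_p)`, `p ≠ 2`), the
hypothesis `hLG` HOLDS (with the cusp clauses vacuous).  Consistency evidence only; not a curve.
[cite: MochizukiSemiAnbd2006, Thm 6.5(iii) p.72] -/
theorem exists_principal_levelwiseCuspGraphIso (p : ℕ) [Fact p.Prime] (hp : p ≠ 2) :
    ∃ (X : TemperedCurve p) (Ω : TemperedOrigin p), (∀ Y, Ω.IsHyperbolicCurveOrigin Y ↔ Y = X) ∧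
      ∀ X' Y' : TemperedCurve p, Ω.IsHyperbolicCurveOrigin X' → Ω.IsHyperbolicCurveOrigin Y' →
      ∀ γ : X'.DeltaTemp ≃ₜ* Y'.DeltaTemp,
      ∃ (TX : SpecialFibreTower X'.DeltaTemp) (TY : SpecialFibreTower Y'.DeltaTemp)
        (AX : ∀ i, X'.PiTemp →* Aut (TX.Gc i).graph) (AY : ∀ i, Y'.PiTemp →* Aut (TY.Gc i).graph)
        (cX : ∀ i, {x : X'.Pt // X'.IsCusp x} → (TX.Gc i).graph.Edge)
        (cY : ∀ i, {y : Y'.Pt // Y'.IsCusp y} → (TY.Gc i).graph.Edge)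
        (FI : ∀ i, (TX.Gc i).graph ≅ (TY.Gc i).graph),
        (∀ (x : {x : X'.Pt // X'.IsCusp x}) (g : X'.DeltaTemp), (g : X'.PiTemp) ∈ X'.inertia x.1 ↔
            ∀ i, (AX i (g : X'.PiTemp)).hom.edgeMap (cX i x) = cX i x) ∧
        (∀ (y : {y : Y'.Pt // Y'.IsCusp y}) (h : Y'.DeltaTemp), (h : Y'.PiTemp) ∈ Y'.inertia y.1 ↔
            ∀ i, (AY i (h : Y'.PiTemp)).hom.edgeMap (cY i y) = cY i y) ∧
        (∀ (i) (g : X'.DeltaTemp) (e : (TX.Gc i).graph.Edge),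
            (FI i).hom.edgeMap ((AX i (g : X'.PiTemp)).hom.edgeMap e) =
              (AY i ((γ g : Y'.DeltaTemp) : Y'.PiTemp)).hom.edgeMap ((FI i).hom.edgeMap e)) ∧
        (∀ x : {x : X'.Pt // X'.IsCusp x}, ∃ (y : {y : Y'.Pt // Y'.IsCusp y}) (δ : Y'.PiTemp),
            ∀ i, (FI i).hom.edgeMap (cX i x) = (AY i δ).hom.edgeMap (cY i y)) := by
  obtain ⟨X, _, _, T, -, -, hPt, -⟩ := SpecialFibreTower.PiData.exists_temperedCurve_padicAffine (p := p) hp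
  refine ⟨X, ⟨fun Y => Y = X⟩, fun Y => Iff.rfl, ?_⟩
  intro X' Y' hX' hY' γ
  cases hX'
  cases hY'
  exact TemperedCurve.levelwiseCuspGraphIso_data_of_isEmpty_pt _ hPt T γ

end TemperedOrigin

end Literature.AnabelianGeometry.SemiGraphs

end
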